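import Literature.Topology.FourManifolds.SectionCircleNbhd
import Literature.Topology.FourManifolds.SphereIsometryDiffeotopy
import Mathlib.Analysis.SpecialFunctions.SmoothTransition
import HarnessLib

/-!
# Four-sphere recognition from a slice-preserving genus-one gluing, II: angle calculus on the
# circle — helpers for stub `stub_sliceRecognition` of line `Sketch`, crux `SblfDescent.RungOne`

(Crux item stmt-SmoothPoincare4-18531; skeleton `Cruxes/RungOne/Lines/Sketch.lean`.)

A slice-preserving gluing diffeomorphism of `S² × S¹` is a circle's worth `w ↦ g_w` of
diffeomorphisms of `S²`; the recognition argument reads this loop in `Diff(S²)` through the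
angle coordinate `angA : 𝕊¹ → (0, 1]` of the tree (`TorusCoordinates.lean`,
`SectionCircleNbhd.lean`: smooth away from
the base point `ptA = (1, 0)`, `circlePt ∘ angA = id`).  This file is the calculus making
functions of the angle smooth ACROSS the cut at `ptA`:

* `angA_lt_or_lt_of_pos` — on the open half circle `{u₀ > 0}` around `ptA` the angle lies in
  `(0, 1/4) ∪ (3/4, 1]`;
* `contMDiff_comp_angA` — **a smooth family `K s` of maps, constant in `s` off `(1/4, 3/4)`,
  evaluated at the angle `s = angA (u n)` of a smooth circle-valued map `u`, is smooth** (near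
  the cut the composite is the constant member of the family; elsewhere `angA` is smooth);
* `helper_sliceRec_rho` (registered helper) — **a smooth homotopy `ρ_t : 𝕊¹ → 𝕊¹` from the
  identity to the reparametrisation `u ↦ circlePt (β (angA u))`**, `β(s) =
  smoothTransition (2s - 1/2)` (flat: `β = 0` on `s ≤ 1/4`, `β = 1` on `s ≥ 3/4`), which
  collapses a neighbourhood of `ptA` to `ptA`: `ρ_t u = circlePt (a + t (β a - a))`, `a = angA u`,
  read near the cut in the second angle chart `angB` as `circlePt ((1 - t)(angB u - 1))`;
* `contDiff_linearIsometryEquiv_symm`, `exists_diffeotopy_sphereCongr` — a smooth family of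
  linear isometries of `ℝ³` has a smooth inverse family (`Ring.inverse` is smooth at units) and
  acts on `S²` by a diffeotopy (`Diffeotopy.ofLinearIsometryFamily`); adapted from
  `SphereDiffeoLoops.lean`.

Everything is proved; no definitions, no named facts, no local notation.

## References

* J. Cerf, *Sur les difféomorphismes de la sphère de dimension trois (Γ₄ = 0)*, LNM 53 (1968),
  Ch. I §1 (reparametrisation of paths in `Diff` to be stationary near the ends).
  [CerfDiffeoSphere1968]
* M. W. Hirsch, *Differential Topology* (1976), Ch. 8 §1. [HirschDT1976]
-/

-- the prescribed namespace `Summit.<P>.<Sub>.…` duplicates `SmoothPoincare4` (P = Sub)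
set_option linter.dupNamespace false

noncomputable section

open scoped Manifold ContDiff Topology Real
open Set Function Complex Literature.Topology.FourManifolds

namespace Summit.SmoothPoincare4.SmoothPoincare4.Cruxes.RungOne.Sketch

/-! ### The angle near the base point -/

/-- The base point `ptA = (1, 0)` has first coordinate `1`. [folklore] -/
theorem ptA_apply_zero : ((ptA : Metric.sphere (0 : EuclideanSpace ℝ (Fin 2)) 1) :
    EuclideanSpace ℝ (Fin 2)) 0 = 1 := by
  show ((circlePt 0 : Metric.sphere (0 : EuclideanSpace ℝ (Fin 2)) 1) : EuclideanSpace ℝ (Fin 2)) 0 = 1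
  rw [circlePt_apply_zero, mul_zero, Real.cos_zero]

/-- The antipode `ptB = (-1, 0)` has first coordinate `-1`. [folklore] -/
theorem ptB_apply_zero : ((ptB : Metric.sphere (0 : EuclideanSpace ℝ (Fin 2)) 1) :
    EuclideanSpace ℝ (Fin 2)) 0 = -1 := by
  show ((circlePt (1 / 2) : Metric.sphere (0 : EuclideanSpace ℝ (Fin 2)) 1) :
    EuclideanSpace ℝ (Fin 2)) 0 = -1
  rw [circlePt_apply_zero, show 2 * π * (1 / 2) = π by ring, Real.cos_pi]

/-- A point of the circle with positive first coordinate is different from `ptB`. [folklore] -/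
theorem ne_ptB_of_pos {u : Metric.sphere (0 : EuclideanSpace ℝ (Fin 2)) 1}
    (hu : 0 < (u : EuclideanSpace ℝ (Fin 2)) 0) : u ≠ ptB := by
  intro h
  rw [h, ptB_apply_zero] at hu
  linarith

/-- A point of the circle with nonpositive first coordinate is different from `ptA`. [folklore] -/
theorem ne_ptA_of_nonpos {u : Metric.sphere (0 : EuclideanSpace ℝ (Fin 2)) 1}
    (hu : (u : EuclideanSpace ℝ (Fin 2)) 0 ≤ 0) : u ≠ ptA := by
  intro h
  rw [h, ptA_apply_zero] at hu
  linarith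

/-- **On the half circle `{u₀ > 0}` the angle `angA` lies in `(0, 1/4) ∪ (3/4, 1]`** (the
argument of `-u` exceeds `π/2` in absolute value, Mathlib `Complex.abs_arg_le_pi_div_two_iff`).
[folklore] -/
theorem angA_lt_or_lt_of_pos (u : Metric.sphere (0 : EuclideanSpace ℝ (Fin 2)) 1)
    (hu : 0 < (u : EuclideanSpace ℝ (Fin 2)) 0) : angA u < 1 / 4 ∨ 3 / 4 < angA u := by
  have hπ := Real.pi_pos
  have hre : (-toC (u : EuclideanSpace ℝ (Fin 2))).re < 0 := by
    rw [neg_re, toC_re, neg_lt_zero]; exact hu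
  have habs : π / 2 < |arg (-toC (u : EuclideanSpace ℝ (Fin 2)))| := by
    by_contra h
    have h' := abs_arg_le_pi_div_two_iff.1 (not_lt.1 h)
    linarith
  rcases lt_or_ge (arg (-toC (u : EuclideanSpace ℝ (Fin 2)))) 0 with hneg | hnn
  · left
    rw [abs_of_neg hneg] at habs
    have : arg (-toC (u : EuclideanSpace ℝ (Fin 2))) / (2 * π) < -(1 / 4) := by
      rw [div_lt_iff₀ (by positivity)]; linarith
    rw [angA]; linarith
  · right
    rw [abs_of_nonneg hnn] at habs
    have : 1 / 4 < arg (-toC (u : EuclideanSpace ℝ (Fin 2))) / (2 * π) := by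
      rw [lt_div_iff₀ (by positivity)]; linarith
    rw [angA]; linarith

/-- On the half circle `{u₀ > 0}`, `angA ∉ [1/4, 3/4]`, in the form consumed by flat families.
[folklore] -/
theorem angA_le_or_le_of_pos (u : Metric.sphere (0 : EuclideanSpace ℝ (Fin 2)) 1)
    (hu : 0 < (u : EuclideanSpace ℝ (Fin 2)) 0) : angA u ≤ 1 / 4 ∨ 3 / 4 ≤ angA u := by
  rcases angA_lt_or_lt_of_pos u hu with h | h
  · exact Or.inl h.le
  · exact Or.inr h.le

/-! ### Smooth functions of the angle -/

section AngleLift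

variable {EN HN : Type*} [NormedAddCommGroup EN] [NormedSpace ℝ EN] [TopologicalSpace HN]
  {JN : ModelWithCorners ℝ EN HN} {N : Type*} [TopologicalSpace N] [ChartedSpace HN N]
  {EY HY : Type*} [NormedAddCommGroup EY] [NormedSpace ℝ EY] [TopologicalSpace HY]
  {JY : ModelWithCorners ℝ EY HY} {Y : Type*} [TopologicalSpace Y] [ChartedSpace HY Y]

/-- **Smooth families of maps, flat off `(1/4, 3/4)`, evaluated at the angle are smooth.**
Let `K : ℝ → N → Y` be jointly smooth with `K s = K 0` for `s ≤ 1/4` and for `s ≥ 3/4`, and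
`u : N → 𝕊¹` smooth.  Then `n ↦ K (angA (u n)) n` is smooth: on the open set `{u₀ > 0}` it is
`K 0` (`angA ∈ (0, 1/4) ∪ (3/4, 1]` there), and elsewhere `angA ∘ u` is smooth
(`contMDiffAt_angA`).  This is how loops in `Diff(S²)` parametrised by `[0, 1]` and stationary
near the ends descend to smooth families over the circle (Cerf 1968, Ch. I §1).
[cite: CerfDiffeoSphere1968, Ch. I §1] -/
theorem contMDiff_comp_angA (K : ℝ → N → Y)
    (u : N → Metric.sphere (0 : EuclideanSpace ℝ (Fin 2)) 1)
    (hK : ContMDiff (𝓘(ℝ, ℝ).prod JN) JY ∞ fun p : ℝ × N => K p.1 p.2)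
    (hflat : ∀ s : ℝ, s ≤ 1 / 4 ∨ 3 / 4 ≤ s → ∀ n, K s n = K 0 n)
    (hu : ContMDiff JN (𝓡 1) ∞ u) :
    ContMDiff JN JY ∞ fun n => K (angA (u n)) n := by
  intro n₀
  by_cases hpos : 0 < ((u n₀ : Metric.sphere (0 : EuclideanSpace ℝ (Fin 2)) 1) :
      EuclideanSpace ℝ (Fin 2)) 0
  · have hc : Continuous fun n : N =>
        ((u n : Metric.sphere (0 : EuclideanSpace ℝ (Fin 2)) 1) : EuclideanSpace ℝ (Fin 2)) 0 :=
      (EuclideanSpace.proj (0 : Fin 2)).continuous.comp (continuous_subtype_val.comp hu.continuous)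
    have hopen : IsOpen {n : N |
        0 < ((u n : Metric.sphere (0 : EuclideanSpace ℝ (Fin 2)) 1) : EuclideanSpace ℝ (Fin 2)) 0} :=
      isOpen_lt continuous_const hc
    have hK0 : ContMDiff JN JY ∞ fun n => K 0 n :=
      hK.comp (contMDiff_const.prodMk contMDiff_id)
    refine (hK0 n₀).congr_of_eventuallyEq ?_
    filter_upwards [hopen.mem_nhds hpos] with n hn
    exact hflat _ (angA_le_or_le_of_pos (u n) hn) n
  · have hne : u n₀ ≠ ptA := ne_ptA_of_nonpos (not_lt.1 hpos)
    have ha : ContMDiffAt JN 𝓘(ℝ, ℝ) ∞ (fun n => angA (u n)) n₀ :=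
      (contMDiffAt_angA hne).comp n₀ (hu n₀)
    have h2 : ContMDiffAt JN (𝓘(ℝ, ℝ).prod JN) ∞ (fun n => (angA (u n), n)) n₀ :=
      ha.prodMk contMDiffAt_id
    exact (hK _).comp n₀ h2

end AngleLift

/-! ### The collapsing reparametrisation of the circle -/

/-- **Registered helper `helper_sliceRec_rho`: the collapsing homotopy of the circle.**  There
is a jointly smooth `ρ : ℝ × 𝕊¹ → 𝕊¹` with `ρ₀ = id` and `ρ₁ u = circlePt (β (angA u))`,
`β(s) = smoothTransition (2s - 1/2)`; since `β` is `0` on `s ≤ 1/4` and `1` on `s ≥ 3/4`,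
`ρ₁` collapses the arc `{u₀ > 0}` to the base point `ptA`.  Formula:
`ρ_t u = circlePt (a + t (β a - a))`, `a = angA u`; near the cut `ptA` of `angA` this equals
`circlePt ((1 - t)(angB u - 1))` (transition rule `angB_eq_of_ne` and periodicity of
`circlePt`), which is smooth there. [cite: CerfDiffeoSphere1968, Ch. I §1] -/
theorem helper_sliceRec_rho : ∃ ρ : ℝ → Metric.sphere (0 : EuclideanSpace ℝ (Fin 2)) 1 → Metric.sphere (0 : EuclideanSpace ℝ (Fin 2)) 1, ContMDiff (𝓘(ℝ, ℝ).prod (𝓡 1)) (𝓡 1) ∞ (fun p : ℝ × Metric.sphere (0 : EuclideanSpace ℝ (Fin 2)) 1 => ρ p.1 p.2) ∧ (∀ u, ρ 0 u = u) ∧ (∀ u, ρ 1 u = circlePt (Real.smoothTransition (2 * angA u - 1 / 2))) := by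
  refine ⟨fun t u => circlePt (angA u + t * (Real.smoothTransition (2 * angA u - 1 / 2) - angA u)),
    ?_, fun u => ?_, fun u => ?_⟩
  · -- the smooth real function `(t, a) ↦ a + t (β a - a)`
    have hg : ContDiff ℝ ∞ fun q : ℝ × ℝ =>
        q.2 + q.1 * (Real.smoothTransition (2 * q.2 - 1 / 2) - q.2) := by
      have hβ : ContDiff ℝ ∞ fun q : ℝ × ℝ => Real.smoothTransition (2 * q.2 - 1 / 2) :=
        Real.smoothTransition.contDiff.comp ((contDiff_const.mul contDiff_snd).sub contDiff_const)
      exact contDiff_snd.add (contDiff_fst.mul (hβ.sub contDiff_snd))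
    rintro ⟨t₀, u₀⟩
    by_cases hpos : 0 < ((u₀ : Metric.sphere (0 : EuclideanSpace ℝ (Fin 2)) 1) :
        EuclideanSpace ℝ (Fin 2)) 0
    · -- near the cut: the `angB` expression
      have hB : u₀ ≠ ptB := ne_ptB_of_pos hpos
      have hlin : ContDiff ℝ ∞ fun q : ℝ × ℝ => (1 - q.1) * (q.2 - 1) :=
        (contDiff_const.sub contDiff_fst).mul (contDiff_snd.sub contDiff_const)
      have hB2 : ContMDiffAt (𝓘(ℝ, ℝ).prod (𝓡 1)) 𝓘(ℝ, ℝ) ∞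
          (fun p : ℝ × Metric.sphere (0 : EuclideanSpace ℝ (Fin 2)) 1 => angB p.2) (t₀, u₀) :=
        ContMDiffAt.comp (t₀, u₀) (g := angB) (f := Prod.snd) (contMDiffAt_angB hB) contMDiffAt_snd
      have h1 : ContMDiffAt (𝓘(ℝ, ℝ).prod (𝓡 1)) 𝓘(ℝ, ℝ × ℝ) ∞
          (fun p : ℝ × Metric.sphere (0 : EuclideanSpace ℝ (Fin 2)) 1 => (p.1, angB p.2)) (t₀, u₀) :=
        contMDiffAt_fst.prodMk_space hB2
      have hsm : ContMDiffAt (𝓘(ℝ, ℝ).prod (𝓡 1)) (𝓡 1) ∞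
          (fun p : ℝ × Metric.sphere (0 : EuclideanSpace ℝ (Fin 2)) 1 =>
            circlePt ((1 - p.1) * (angB p.2 - 1))) (t₀, u₀) :=
        contMDiff_circlePt.contMDiffAt.comp _ (hlin.contDiffAt.comp_contMDiffAt h1)
      refine hsm.congr_of_eventuallyEq ?_
      have hc : Continuous fun p : ℝ × Metric.sphere (0 : EuclideanSpace ℝ (Fin 2)) 1 =>
          ((p.2 : Metric.sphere (0 : EuclideanSpace ℝ (Fin 2)) 1) : EuclideanSpace ℝ (Fin 2)) 0 :=
        (EuclideanSpace.proj (0 : Fin 2)).continuous.comp (continuous_subtype_val.comp continuous_snd)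
      have hopen : IsOpen {p : ℝ × Metric.sphere (0 : EuclideanSpace ℝ (Fin 2)) 1 |
          0 < ((p.2 : Metric.sphere (0 : EuclideanSpace ℝ (Fin 2)) 1) : EuclideanSpace ℝ (Fin 2)) 0} :=
        isOpen_lt continuous_const hc
      filter_upwards [hopen.mem_nhds hpos] with p hp
      rcases p with ⟨t, u⟩
      show circlePt (angA u + t * (Real.smoothTransition (2 * angA u - 1 / 2) - angA u)) =
        circlePt ((1 - t) * (angB u - 1))
      by_cases hA : u = ptA
      · rw [hA, angA_ptA, angB_ptA, Real.smoothTransition.one_of_one_le (by norm_num)]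
        simpa using circlePt_add_one 0
      · rcases angB_eq_of_ne hA (ne_ptB_of_pos hp) with ⟨hlt, hB1⟩ | ⟨hgt, hB1⟩
        · rcases angA_lt_or_lt_of_pos u hp with h | h
          · rw [Real.smoothTransition.zero_of_nonpos (by linarith), hB1]
            congr 1; ring
          · exfalso; linarith
        · rcases angA_lt_or_lt_of_pos u hp with h | h
          · exfalso; linarith
          · rw [Real.smoothTransition.one_of_one_le (by linarith), hB1,
              show (1 - t) * (angA u - 1) = (angA u + t * (1 - angA u)) - 1 by ring]
            conv_rhs => rw [← circlePt_add_one]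
            congr 1; ring
    · -- away from the cut: `angA` is smooth
      have hA : u₀ ≠ ptA := ne_ptA_of_nonpos (not_lt.1 hpos)
      have hA2 : ContMDiffAt (𝓘(ℝ, ℝ).prod (𝓡 1)) 𝓘(ℝ, ℝ) ∞
          (fun p : ℝ × Metric.sphere (0 : EuclideanSpace ℝ (Fin 2)) 1 => angA p.2) (t₀, u₀) :=
        ContMDiffAt.comp (t₀, u₀) (g := angA) (f := Prod.snd) (contMDiffAt_angA hA) contMDiffAt_snd
      have h1 : ContMDiffAt (𝓘(ℝ, ℝ).prod (𝓡 1)) 𝓘(ℝ, ℝ × ℝ) ∞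
          (fun p : ℝ × Metric.sphere (0 : EuclideanSpace ℝ (Fin 2)) 1 => (p.1, angA p.2)) (t₀, u₀) :=
        contMDiffAt_fst.prodMk_space hA2
      exact contMDiff_circlePt.contMDiffAt.comp _ (hg.contDiffAt.comp_contMDiffAt h1)
  · show circlePt (angA u + 0 * (Real.smoothTransition (2 * angA u - 1 / 2) - angA u)) = u
    rw [zero_mul, add_zero, circlePt_angA]
  · show circlePt (angA u + 1 * (Real.smoothTransition (2 * angA u - 1 / 2) - angA u)) = _
    congr 1; ring

/-! ### Smooth families of linear isometries -/

/-- **The inverse of a smooth family of linear isometries of `ℝ³` is smooth** (as a family of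
continuous linear maps): `(A t)⁻¹ = Ring.inverse (A t)` and `Ring.inverse` is smooth at units
(Mathlib `contDiffAt_ringInverse`).  Adapted from `SphereDiffeoLoops.lean`. [folklore] -/
theorem contDiff_linearIsometryEquiv_symm
    {A : ℝ → (EuclideanSpace ℝ (Fin 3) ≃ₗᵢ[ℝ] EuclideanSpace ℝ (Fin 3))}
    (hA : ContDiff ℝ ∞ fun t => (A t : EuclideanSpace ℝ (Fin 3) →L[ℝ] EuclideanSpace ℝ (Fin 3))) :
    ContDiff ℝ ∞ fun t =>
      ((A t).symm : EuclideanSpace ℝ (Fin 3) →L[ℝ] EuclideanSpace ℝ (Fin 3)) := by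
  -- adapted from `exists_loopHomotopy_frameLoop_of_families` (SphereDiffeoLoops.lean)
  have hAunit : ∀ t, IsUnit (A t : EuclideanSpace ℝ (Fin 3) →L[ℝ] EuclideanSpace ℝ (Fin 3)) :=
    fun t => ContinuousLinearMap.isUnit_iff_bijective.mpr (A t).bijective
  have hAinv : ∀ t, Ring.inverse (A t : EuclideanSpace ℝ (Fin 3) →L[ℝ] EuclideanSpace ℝ (Fin 3)) =
      ((A t).symm : EuclideanSpace ℝ (Fin 3) →L[ℝ] EuclideanSpace ℝ (Fin 3)) := by
    intro t
    have h1 : Ring.inverse (A t : EuclideanSpace ℝ (Fin 3) →L[ℝ] EuclideanSpace ℝ (Fin 3)) *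
        (A t : EuclideanSpace ℝ (Fin 3) →L[ℝ] EuclideanSpace ℝ (Fin 3)) = 1 :=
      Ring.inverse_mul_cancel _ (hAunit t)
    ext1 y
    have h2 := congrArg (fun L : EuclideanSpace ℝ (Fin 3) →L[ℝ] EuclideanSpace ℝ (Fin 3) =>
      L ((A t).symm y)) h1
    simp only [mul_apply_eq_comp, one_apply_eq_self] at h2
    have h3 : (A t : EuclideanSpace ℝ (Fin 3) →L[ℝ] EuclideanSpace ℝ (Fin 3)) ((A t).symm y) = y :=
      (A t).apply_symm_apply y
    rw [h3] at h2
    exact h2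
  rw [contDiff_iff_contDiffAt]
  intro t
  have h3 : ContDiffAt ℝ ∞ Ring.inverse
      (A t : EuclideanSpace ℝ (Fin 3) →L[ℝ] EuclideanSpace ℝ (Fin 3)) := by
    have := contDiffAt_ringInverse ℝ (n := ∞) (hAunit t).unit
    rwa [(hAunit t).unit_spec] at this
  have h4 := h3.comp t hA.contDiffAt
  refine h4.congr_of_eventuallyEq (Filter.Eventually.of_forall fun s => ?_)
  exact (hAinv s).symm

/-- **A smooth family of linear isometries of `ℝ³` starting at the identity acts on `S²` by a
diffeotopy** (`Diffeotopy.ofLinearIsometryFamily`, `SphereIsometryDiffeotopy.lean`), with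
stages `sphereCongr (A t)` and inverse stages `sphereCongr (A t)⁻¹`; in particular both
`(t, x) ↦ A t x` and `(t, x) ↦ (A t)⁻¹ x` are jointly smooth on `ℝ × S²`. [folklore] -/
theorem exists_diffeotopy_sphereCongr
    (A : ℝ → (EuclideanSpace ℝ (Fin 3) ≃ₗᵢ[ℝ] EuclideanSpace ℝ (Fin 3)))
    (hA : ContDiff ℝ ∞ fun t => (A t : EuclideanSpace ℝ (Fin 3) →L[ℝ] EuclideanSpace ℝ (Fin 3)))
    (h0 : A 0 = LinearIsometryEquiv.refl ℝ (EuclideanSpace ℝ (Fin 3))) :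
    ∃ D : Diffeotopy (𝓡 2) (Metric.sphere (0 : EuclideanSpace ℝ (Fin 3)) 1),
      (∀ t x, D.toFun t x = sphereCongr (A t) x) ∧
      (∀ t x, D.invFun t x = (sphereCongr (A t)).symm x) := by
  have hAcl : ContDiff ℝ ∞ fun p : ℝ × EuclideanSpace ℝ (Fin 3) => A p.1 p.2 :=
    (hA.comp contDiff_fst).clm_apply contDiff_snd
  have hAcl' : ContDiff ℝ ∞ fun p : ℝ × EuclideanSpace ℝ (Fin 3) => (A p.1).symm p.2 :=
    ((contDiff_linearIsometryEquiv_symm hA).comp contDiff_fst).clm_apply contDiff_snd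
  refine ⟨Diffeotopy.ofLinearIsometryFamily A hAcl hAcl' h0, fun t x => ?_, fun t x => ?_⟩
  · rw [← Diffeotopy.coe_stage, Diffeotopy.ofLinearIsometryFamily_stage]
  · rw [← Diffeotopy.coe_stage_symm, Diffeotopy.ofLinearIsometryFamily_stage]

end Summit.SmoothPoincare4.SmoothPoincare4.Cruxes.RungOne.Sketch

end
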